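import Literature.NumberTheory.EllipticCurves.ShaRestrictionJZeroLocalDescent
import Literature.NumberTheory.EllipticCurves.H1CorestrictionIndexTwo
import Literature.NumberTheory.EllipticCurves.VariableChangePointsMap
import Literature.NumberTheory.EllipticCurves.GaloisActionProofs
import Literature.NumberTheory.EllipticCurves.SelmerProofs
import HarnessLib

/-!
# CM corestriction: invariant classes of `H¹(K, E)` are restrictions, for `j = 0` short models

The second half of the exact descent of `H¹` (and of `Ш`) along `K = ℚ(ω) ⊇ ℚ` for an elliptic
curve `E : y² = x³ + B` over `ℚ` (files `ShaRestrictionJZeroDescent`: `res` is injective;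
`ShaRestrictionJZeroLocalDescent`: `Ш(E/ℚ) = res⁻¹ Ш(E_K/K)`): every class of `H¹(K, E)` fixed by
the generator of `Gal(K/ℚ)` is the restriction of a class of `H¹(ℚ, E)`.

* §1 (generic continuous cohomology, the setting of `H1CorestrictionIndexTwo`: a topological group
  `G`, an open normal subgroup `N` of index `2` with `G = N ⊔ N c`, a discrete `G`-module `M`).
  **CM corestriction** `resSubgroupH1_corH1_neg_h1Equiv_of_conjH1_eq`: if `M` carries an additive
  automorphism `ψ` commuting with `N`, `c`-SEMILINEAR (`c ψ = ψ² c`) and with `ψ² + ψ + 1 = 0`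
  (a `ℤ[ω]`-module structure on which `c` acts `ω`-antilinearly), then every `c_*`-invariant class
  `ξ ∈ H¹(N, M)` is a restriction: `ξ = res (cor (−ψ_* ξ))`, by `res ∘ cor = 1 + c_*`
  (`resSubgroupH1_corH1`), `c_* ψ_* = ψ_*² c_*` (`conjH1_h1Equiv_of_semilinear`) and
  `ψ_*² + ψ_* + 1 = 0` (`h1Equiv_h1Equiv_add_eq_zero`). (For comparison: without `ψ` one only gets
  `2ξ = res (cor ξ)`, the tree's `IndexTwoDecompositionData`.)
* §2 **The automorphism `[ω]` of `E(k̄)`** for a `j = 0` short model over any field `k` of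
  characteristic `0` (`JZero.exists_cm_addEquiv`: `(x, y) ↦ (ζ' x, y)`, the substitution
  isomorphism of the change of variables `u = ζ'`, `VariableChange.pointEquiv`), its
  `Γ_k`-equivariance over the stabiliser of `ζ'`, its semilinearity under elements acting by
  `ζ' ↦ ζ'²`, and the trace identity `[ω]² + [ω] + 1 = 0` (`horizontal_some_add_some_eq_neg`).
* §3 **The subgroup model** (`N = galRange K = Γ_K ≤ Γ_ℚ`, `c = liftToAbsGal K σ`,
  `M = E(ℚ̄)`): `JZero.exists_resSubgroupH1_eq_of_conjH1_eq` — every `c_*`-invariant class of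
  `H¹(galRange K, E(ℚ̄))` is the restriction of a class of `H¹(ℚ, E) = W.galH1`.

Everything here is proved; no new definitions.

## References

* J.-P. Serre, *Galois Cohomology* (1997), I.§2.4 (res, cor; Prop. 9 and Cor.), I.§2.5, I.§5.8.
  [SerreGaloisCohomology1997]
* J. Neukirch, A. Schmidt, K. Wingberg, *Cohomology of Number Fields*, 2nd ed. (2008), I.§5.
  [NeukirchSchmidtWingberg2008]
* J. H. Silverman, *The Arithmetic of Elliptic Curves*, 2nd ed. (2009), III.3.1(b), III.10.1.
  [SilvermanAEC2009]
* B. H. Gross, Kolyvagin's work on modular elliptic curves (1991), §5 (5.1)–(5.2) (the Heegner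
  analogue: `res : Sel(E/ℚ) ⥲ Sel(E/K)^{Gal}` for odd `p` by `cor ∘ res = 2`). [GrossLMS1991]
-/

noncomputable section

open scoped Classical

universe u

namespace Literature.NumberTheory.EllipticCurves

open GaloisRepresentations WeierstrassCurve

/-! ## §1 CM corestriction on continuous `H¹` along an open normal subgroup of index `2` -/

section CMCorestriction

variable {G : Type u} [Group G] [TopologicalSpace G] [IsTopologicalGroup G]
variable {N : Subgroup G} [N.Normal] {c : G}
variable {M : Type u} [AddCommGroup M] [DistribMulAction G M] [TopologicalSpace M]
  [DiscreteTopology M]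

/-- **Semilinearity on `H¹`.** Let `ψ : M ≃ M` be additive, `N`-equivariant, and `c`-semilinear in
the sense `c • ψ m = ψ (ψ (c • m))` (`c ψ c⁻¹ = ψ²`, e.g. `ψ = [ω]`, `c` complex conjugation,
`ω̄ = ω²`). Then on `H¹(N, M)`: `c_* ∘ ψ_* = ψ_* ∘ ψ_* ∘ c_*` (`ψ_* = h1Equiv ψ`, `c_* = conjH1 N M c`);
on cocycles both sides are `n ↦ c • ψ (f (c⁻¹ n c))`. Serre, *Galois Cohomology*, I.§2.5
(functoriality of conjugation in the pair). [cite: SerreGaloisCohomology1997, I.§2.4 (Prop. 9 and Cor.) and I.§5.8] -/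
theorem conjH1_h1Equiv_of_semilinear (ψ : M ≃+ M) (hψ : ∀ (n : N) (m : M), ψ (n • m) = n • ψ m)
    (hψc : ∀ m : M, c • ψ m = ψ (ψ (c • m))) (ξ : subgroupH1 N M) :
    conjH1 N M c (h1Equiv ψ hψ ξ) = h1Equiv ψ hψ (h1Equiv ψ hψ (conjH1 N M c ξ)) := by
  obtain ⟨f, rfl⟩ := oneCocycleClass_surjective _ ξ
  simp only [h1Equiv_apply, resH1Hom_id_oneCocycleClass, conjH1_oneCocycleClass]
  congr 1
  apply Subtype.ext
  ext n
  exact hψc _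

omit [N.Normal] in
/-- **The trace identity on `H¹`.** If `ψ² + ψ + 1 = 0` on `M` then `ψ_*² + ψ_* + 1 = 0` on
`H¹(N, M)` (functoriality is additive in the coefficient endomorphism; on cocycles it is the
pointwise identity). Serre, *Galois Cohomology*, I.§2.4. [cite: SerreGaloisCohomology1997, I.§2.4 (Prop. 9 and Cor.) and I.§5.8] -/
theorem h1Equiv_h1Equiv_add_eq_zero (ψ : M ≃+ M) (hψ : ∀ (n : N) (m : M), ψ (n • m) = n • ψ m)
    (hψ3 : ∀ m : M, ψ (ψ m) + ψ m + m = 0) (ξ : subgroupH1 N M) :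
    h1Equiv ψ hψ (h1Equiv ψ hψ ξ) + h1Equiv ψ hψ ξ + ξ = 0 := by
  obtain ⟨f, rfl⟩ := oneCocycleClass_surjective _ ξ
  simp only [h1Equiv_apply, resH1Hom_id_oneCocycleClass]
  rw [← oneCocycleClass_add, ← oneCocycleClass_add]
  have h0 : contOneCocycles.push (ψ : M →+ M) hψ (contOneCocycles.push (ψ : M →+ M) hψ f) +
      contOneCocycles.push (ψ : M →+ M) hψ f + f = 0 := by
    apply Subtype.ext
    ext n
    rw [add_apply_val, add_apply_val]
    exact hψ3 _
  rw [h0, oneCocycleClass_zero]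

/-- **CM CORESTRICTION: invariant classes are restrictions.** Let `N ≤ G` be an open normal
subgroup of index `2` (`G = N ⊔ N c`), `M` a discrete `G`-module (continuous orbit maps), and
`ψ : M ≃ M` additive, `N`-equivariant, `c`-semilinear (`c • ψ m = ψ² (c • m)`) with
`ψ² + ψ + 1 = 0`. Then every `ξ ∈ H¹(N, M)` with `c_* ξ = ξ` is a restriction:
`res (cor (−ψ_* ξ)) = −(ψ_* ξ + c_* ψ_* ξ) = −(ψ_* ξ + ψ_*² ξ) = ξ`
(`resSubgroupH1_corH1`: `res ∘ cor = 1 + c_*`). This is the mechanism making restriction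
`H¹(ℚ, E) → H¹(K, E)^{Gal(K/ℚ)}` SURJECTIVE with no `2`-torsion error for a `j = 0` curve over
`K = ℚ(ω)` (compare `corH1_resSubgroupH1`, `cor ∘ res = 2`, which alone gives it up to `2`-torsion,
and Gross's `p` odd). Serre, *Galois Cohomology*, I.§2.4 Prop. 9 and Cor.; Neukirch–Schmidt–Wingberg
I.§5. [cite: SerreGaloisCohomology1997, I.§2.4 (Prop. 9 and Cor.) and I.§5.8]
[cite: NeukirchSchmidtWingberg2008, I.§5] -/
theorem resSubgroupH1_corH1_neg_h1Equiv_of_conjH1_eq (hN : IsOpen (N : Set G))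
    (hM : ∀ m : M, Continuous fun g : G ↦ g • m) (hc : ∀ b : G, Xor (b * c⁻¹ ∈ N) (b ∈ N))
    (ψ : M ≃+ M) (hψ : ∀ (n : N) (m : M), ψ (n • m) = n • ψ m)
    (hψc : ∀ m : M, c • ψ m = ψ (ψ (c • m))) (hψ3 : ∀ m : M, ψ (ψ m) + ψ m + m = 0)
    {ξ : subgroupH1 N M} (hξ : conjH1 N M c ξ = ξ) :
    resSubgroupH1 N M (corH1 hN hM hc (-(h1Equiv ψ hψ ξ))) = ξ := by
  rw [map_neg, map_neg, resSubgroupH1_corH1, conjH1_h1Equiv_of_semilinear ψ hψ hψc, hξ]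
  have h := h1Equiv_h1Equiv_add_eq_zero ψ hψ hψ3 ξ
  set A := h1Equiv ψ hψ ξ
  set B := h1Equiv ψ hψ A
  rw [add_comm B A] at h
  exact add_eq_zero_iff_neg_eq.mp h

/-- **CM corestriction, surjectivity form**: under the hypotheses of
`resSubgroupH1_corH1_neg_h1Equiv_of_conjH1_eq`, the `c_*`-invariants of `H¹(N, M)` lie in the
image of `res : H¹(G, M) → H¹(N, M)` (and conversely `c_* ∘ res = res`, `conjH1_resSubgroupH1`).
[cite: SerreGaloisCohomology1997, I.§2.4 (Prop. 9 and Cor.) and I.§5.8] -/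
theorem exists_resSubgroupH1_eq_of_conjH1_eq (hN : IsOpen (N : Set G))
    (hM : ∀ m : M, Continuous fun g : G ↦ g • m) (hc : ∀ b : G, Xor (b * c⁻¹ ∈ N) (b ∈ N))
    (ψ : M ≃+ M) (hψ : ∀ (n : N) (m : M), ψ (n • m) = n • ψ m)
    (hψc : ∀ m : M, c • ψ m = ψ (ψ (c • m))) (hψ3 : ∀ m : M, ψ (ψ m) + ψ m + m = 0)
    {ξ : subgroupH1 N M} (hξ : conjH1 N M c ξ = ξ) :
    ∃ η : discreteH1 G M, resSubgroupH1 N M η = ξ :=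
  ⟨_, resSubgroupH1_corH1_neg_h1Equiv_of_conjH1_eq hN hM hc ψ hψ hψc hψ3 hξ⟩

/-- **`res` maps ONTO the `c_*`-invariants** (set form): under the hypotheses of
`resSubgroupH1_corH1_neg_h1Equiv_of_conjH1_eq`, the image of `res : H¹(G, M) → H¹(N, M)` is
exactly `{ξ | c_* ξ = ξ}`. [cite: SerreGaloisCohomology1997, I.§2.4 (Prop. 9 and Cor.) and I.§5.8] -/
theorem range_resSubgroupH1_eq_of_semilinear (hN : IsOpen (N : Set G))
    (hM : ∀ m : M, Continuous fun g : G ↦ g • m) (hc : ∀ b : G, Xor (b * c⁻¹ ∈ N) (b ∈ N))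
    (ψ : M ≃+ M) (hψ : ∀ (n : N) (m : M), ψ (n • m) = n • ψ m)
    (hψc : ∀ m : M, c • ψ m = ψ (ψ (c • m))) (hψ3 : ∀ m : M, ψ (ψ m) + ψ m + m = 0) :
    ((resSubgroupH1 N M).range : Set (subgroupH1 N M)) = {ξ | conjH1 N M c ξ = ξ} := by
  ext ξ
  simp only [SetLike.mem_coe, AddMonoidHom.mem_range, Set.mem_setOf_eq]
  constructor
  · rintro ⟨η, rfl⟩
    exact conjH1_resSubgroupH1 N hM c η
  · exact fun hξ ↦ exists_resSubgroupH1_eq_of_conjH1_eq hN hM hc ψ hψ hψc hψ3 hξ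

/-- **CM DESCENT, injectivity half (abstract).** Under the hypotheses of
`resSubgroupH1_corH1_neg_h1Equiv_of_conjH1_eq` (`N ≤ G` open normal of index `2`, `G = N ⊔ N c`,
`ψ : M ≃ M` additive, `N`-equivariant, `c • ψ m = ψ² (c • m)`, `ψ² + ψ + 1 = 0`) the restriction
`res : H¹(G, M) → H¹(N, M)` is INJECTIVE: a kernel class is inflated from a crossed homomorphism `f`
vanishing on `N` (`resKer_le_range_inflClass`), `P = f c` is `N`-fixed with `c P = −P`, and
`Q = ψ P` is a coboundary witness: `c Q − Q = ψ²(−P) − ψ P = P` (`inflClass_eq_zero_of_index_two_of_witness`).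
So `H¹(G/N, M^N) = 0`: the abstract form of `JZero.resBaseChange_injective_of_isPrimitiveRoot`
(`ShaRestrictionJZeroDescent`), valid for every `[ω]`-stable coefficient module (`E(ℚ̄)`, `E[p^∞]`,
`E[n]`). Serre, *Galois Cohomology*, I.§2.4 and I.§5.8.
[cite: SerreGaloisCohomology1997, I.§2.4 (Prop. 9 and Cor.) and I.§5.8] -/
theorem resSubgroupH1_injective_of_semilinear (hN : IsOpen (N : Set G))
    (hc : ∀ b : G, Xor (b * c⁻¹ ∈ N) (b ∈ N))
    (ψ : M ≃+ M) (hψ : ∀ (n : N) (m : M), ψ (n • m) = n • ψ m)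
    (hψc : ∀ m : M, c • ψ m = ψ (ψ (c • m))) (hψ3 : ∀ m : M, ψ (ψ m) + ψ m + m = 0) :
    Function.Injective (resSubgroupH1 N M) := by
  rw [injective_iff_map_eq_zero]
  intro η hη
  have hη' : η ∈ resKer (subgroupIncl N) (AddMonoidHom.id M) (fun _ _ ↦ rfl) := by
    rw [resKer_eq_ker, AddMonoidHom.mem_ker]
    exact hη
  obtain ⟨f, rfl⟩ := resKer_le_range_inflClass (subgroupIncl N) (AddMonoidHom.id M) (fun _ _ ↦ rfl)
    Function.bijective_id N hN (fun n hn ↦ ⟨⟨n, hn⟩, rfl⟩) hη'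
  have hcoset : ∀ g : G, g ∈ N ∨ g * c⁻¹ ∈ N := fun g ↦ by
    rcases hc g with ⟨h1, -⟩ | ⟨h1, -⟩
    · exact Or.inr h1
    · exact Or.inl h1
  have hc2 : c * c ∈ N := mul_self_mem_of_xor hc
  -- `P := f c` is flipped by `c`; `Q := ψ P` is the witness
  have hPflip : c • f.1 c = -f.1 c := by
    have e₀ := cocyclesVanishingOn.cocycle f c c
    rw [cocyclesVanishingOn.apply_of_mem f hc2] at e₀
    exact eq_neg_of_add_eq_zero_right e₀.symm
  refine inflClass_eq_zero_of_index_two_of_witness N hN f hcoset (ψ (f.1 c)) (fun n hn ↦ ?_) ?_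
  · change (⟨n, hn⟩ : N) • ψ (f.1 c) = ψ (f.1 c)
    rw [← hψ ⟨n, hn⟩ (f.1 c)]
    exact congrArg ψ (cocyclesVanishingOn.smul_apply f c hn)
  · rw [hψc, hPflip, map_neg, map_neg]
    have h' : -(ψ (ψ (f.1 c))) = ψ (f.1 c) + f.1 c := by
      rw [neg_eq_iff_eq_neg, eq_neg_iff_add_eq_zero]
      have := hψ3 (f.1 c)
      rwa [add_assoc] at this
    rw [h', add_sub_cancel_left]

end CMCorestriction

/-! ## §2 The automorphism `[ω] : (x, y) ↦ (ζ' x, y)` of `E(k̄)` for a `j = 0` short model -/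

namespace JZero

section CMEndo

variable {k : Type u} [Field k] (W : WeierstrassCurve k) [W.IsElliptic]

/-- On an elliptic `j = 0` short model (all of `a₁, …, a₄` zero) the set of solutions over `k̄` is
stable under `x ↦ ζ' x` for `ζ'³ = 1` (all solutions are nonsingular). Silverman, *AEC*, III.1,
III.10.1. [folklore] -/
private theorem nonsingular_mul_of_cube_eq_one (ha₁ : W.a₁ = 0) (ha₂ : W.a₂ = 0) (ha₃ : W.a₃ = 0)
    (ha₄ : W.a₄ = 0) {ζ' : AlgebraicClosure k} (hζ'3 : ζ' ^ 3 = 1) {x y : AlgebraicClosure k}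
    (h : (W.baseChange (AlgebraicClosure k)).toAffine.Nonsingular x y) :
    (W.baseChange (AlgebraicClosure k)).toAffine.Nonsingular (ζ' * x) y := by
  haveI : (W.baseChange (AlgebraicClosure k)).IsElliptic := by
    rw [WeierstrassCurve.baseChange]; infer_instance
  have hb₁ : (W.baseChange (AlgebraicClosure k)).a₁ = 0 := by simp [WeierstrassCurve.baseChange, ha₁]
  have hb₂ : (W.baseChange (AlgebraicClosure k)).a₂ = 0 := by simp [WeierstrassCurve.baseChange, ha₂]
  have hb₃ : (W.baseChange (AlgebraicClosure k)).a₃ = 0 := by simp [WeierstrassCurve.baseChange, ha₃]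
  have hb₄ : (W.baseChange (AlgebraicClosure k)).a₄ = 0 := by simp [WeierstrassCurve.baseChange, ha₄]
  rw [← Affine.equation_iff_nonsingular] at h ⊢
  rw [Affine.equation_iff'] at h ⊢
  simp only [hb₁, hb₂, hb₃, hb₄, zero_mul, add_zero] at h ⊢
  linear_combination h - x ^ 3 * hζ'3

omit [W.IsElliptic] in
/-- The `Γ_k`-action on an affine geometric point is coordinatewise (definitionally). Silverman,
*AEC*, VIII.§1. [folklore] -/
private theorem smul_some_eq (g : Field.absoluteGaloisGroup k) {x y : AlgebraicClosure k}
    (h : (W.baseChange (AlgebraicClosure k)).toAffine.Nonsingular x y) :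
    ∃ h', @HSMul.hSMul (Field.absoluteGaloisGroup k) (geomPoints W) (geomPoints W) instHSMul g
        (Affine.Point.some x y h) =
      Affine.Point.some ((show AlgebraicClosure k ≃ₐ[k] AlgebraicClosure k from g) x)
        ((show AlgebraicClosure k ≃ₐ[k] AlgebraicClosure k from g) y) h' :=
  ⟨_, rfl⟩

/-- **The automorphism `[ω]` of `E(k̄)`.** For an elliptic `j = 0` short model `E : y² = x³ + B`
over `k` (all of `a₁, …, a₄` zero) and `ζ' ∈ k̄` with `ζ'³ = 1`, there is an additive
automorphism `ψ` of `E(k̄) = geomPoints W` acting on affine points by `(x, y) ↦ (ζ' x, y)`: the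
substitution isomorphism `W(k̄) ≃+ (C • W)(k̄)` of the change of variables `C = (u = ζ', 0, 0, 0)`
(`VariableChange.pointEquiv`, `(x, y) ↦ (u⁻²x, u⁻³y) = (ζ' x, y)`), followed by the transport along
`C • W_{k̄} = W_{k̄}` (`u⁻⁶ B = B`). Silverman, *AEC*, III.3.1(b) and III.10.1 (`Aut E ≅ μ₆` for
`j = 0`). [cite: SilvermanAEC2009, Thm. III.10.1 and Cor. III.10.2] -/
theorem exists_cm_addEquiv (ha₁ : W.a₁ = 0) (ha₂ : W.a₂ = 0) (ha₃ : W.a₃ = 0) (ha₄ : W.a₄ = 0)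
    {ζ' : AlgebraicClosure k} (hζ'3 : ζ' ^ 3 = 1) :
    ∃ ψ : geomPoints W ≃+ geomPoints W,
      ∀ {x y : AlgebraicClosure k} (h : (W.baseChange (AlgebraicClosure k)).toAffine.Nonsingular x y),
        ∃ h', ψ (Affine.Point.some x y h) = Affine.Point.some (ζ' * x) y h' := by
  have hζ'0 : ζ' ≠ 0 := by
    rintro rfl
    norm_num at hζ'3
  have hinv : ζ'⁻¹ = ζ' ^ 2 := inv_eq_of_mul_eq_one_right (by rw [← pow_succ']; exact hζ'3)
  let u : (AlgebraicClosure k)ˣ := Units.mk0 ζ' hζ'0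
  have hu : ((u⁻¹ : (AlgebraicClosure k)ˣ) : AlgebraicClosure k) = ζ' ^ 2 := by
    rw [Units.val_inv_eq_inv_val, Units.val_mk0, hinv]
  let C : VariableChange (AlgebraicClosure k) := ⟨u, 0, 0, 0⟩
  have hb₁ : (W.baseChange (AlgebraicClosure k)).a₁ = 0 := by simp [WeierstrassCurve.baseChange, ha₁]
  have hb₂ : (W.baseChange (AlgebraicClosure k)).a₂ = 0 := by simp [WeierstrassCurve.baseChange, ha₂]
  have hb₃ : (W.baseChange (AlgebraicClosure k)).a₃ = 0 := by simp [WeierstrassCurve.baseChange, ha₃]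
  have hb₄ : (W.baseChange (AlgebraicClosure k)).a₄ = 0 := by simp [WeierstrassCurve.baseChange, ha₄]
  have hCV : C • W.baseChange (AlgebraicClosure k) = W.baseChange (AlgebraicClosure k) := by
    ext
    · rw [WeierstrassCurve.variableChange_a₁, hb₁]
      simp [C]
    · rw [WeierstrassCurve.variableChange_a₂, hb₁, hb₂]
      simp [C]
    · rw [WeierstrassCurve.variableChange_a₃, hb₁, hb₃]
      simp [C]
    · rw [WeierstrassCurve.variableChange_a₄, hb₁, hb₂, hb₃, hb₄]
      simp [C]
    · rw [WeierstrassCurve.variableChange_a₆, hb₁, hb₂, hb₃, hb₄]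
      simp only [C, mul_zero, add_zero, sub_zero, hu]
      have h12 : (ζ' ^ 2) ^ 6 = 1 := by
        rw [← pow_mul, show 2 * 6 = 3 * 4 by norm_num, pow_mul, hζ'3, one_pow]
      rw [h12, one_mul]
      ring
  let ψ₀ : (W.baseChange (AlgebraicClosure k)).toAffine.Point ≃+
      (W.baseChange (AlgebraicClosure k)).toAffine.Point :=
    (VariableChange.pointEquiv (W.baseChange (AlgebraicClosure k)) C).trans
      (Affine.Point.congrEquiv hCV)
  have hψ₀ : ∀ {x y : AlgebraicClosure k}
      (h : (W.baseChange (AlgebraicClosure k)).toAffine.Nonsingular x y),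
      ∃ h', ψ₀ (Affine.Point.some x y h) = Affine.Point.some (ζ' * x) y h' := by
    intro x y h
    refine ⟨nonsingular_mul_of_cube_eq_one W ha₁ ha₂ ha₃ ha₄ hζ'3 h, ?_⟩
    rw [AddEquiv.trans_apply, VariableChange.pointEquiv_some, Affine.Point.congrEquiv_some]
    refine Affine.Point.some_eq_some_of_eq ?_ ?_
    · rw [VariableChange.toX_def, hu]
      change (ζ' ^ 2) ^ 2 * (x - 0) = ζ' * x
      linear_combination x * ζ' * hζ'3
    · rw [VariableChange.toY_def, hu]
      change (ζ' ^ 2) ^ 3 * (y - 0 * (x - 0) - 0) = y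
      linear_combination y * (ζ' ^ 3 + 1) * hζ'3
  exact ⟨ψ₀, hψ₀⟩

variable {W}

omit [W.IsElliptic] in
/-- **`[ω]` commutes with the Galois elements fixing `ζ'`**: `ψ (g P) = g (ψ P)` if `g ζ' = ζ'`
(coordinatewise: `(ζ' g x, g y)` both ways). Silverman, *AEC*, III.10.1. [folklore] -/
private theorem cm_addEquiv_smul_of_apply_eq {ζ' : AlgebraicClosure k} {ψ : geomPoints W ≃+ geomPoints W}
    (hψ : ∀ {x y : AlgebraicClosure k} (h : (W.baseChange (AlgebraicClosure k)).toAffine.Nonsingular x y),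
        ∃ h', ψ (Affine.Point.some x y h) = Affine.Point.some (ζ' * x) y h')
    {g : Field.absoluteGaloisGroup k}
    (hg : (show AlgebraicClosure k ≃ₐ[k] AlgebraicClosure k from g) ζ' = ζ') (P : geomPoints W) :
    ψ (g • P) = g • ψ P := by
  change (W.baseChange (AlgebraicClosure k)).toAffine.Point at P
  rcases P with _ | ⟨x, y, h⟩
  · change ψ (g • (0 : geomPoints W)) = g • ψ 0
    rw [smul_zero, map_zero, smul_zero]
  · obtain ⟨h₁, e₁⟩ := smul_some_eq W g h
    obtain ⟨h₂, e₂⟩ := hψ h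
    obtain ⟨h₃, e₃⟩ := hψ h₁
    obtain ⟨h₄, e₄⟩ := smul_some_eq W g h₂
    refine ((congrArg ψ e₁).trans e₃).trans (Eq.symm (((congrArg (g • ·) e₂).trans e₄).trans ?_))
    exact Affine.Point.some_eq_some_of_eq (by rw [map_mul, hg]) rfl

omit [W.IsElliptic] in
/-- **`[ω]` is semilinear under the Galois elements with `g ζ' = ζ'²`**: `g (ψ P) = ψ (ψ (g P))`
(coordinatewise: `(ζ'² g x, g y)` both ways). Silverman, *AEC*, III.10.1 (`[ω]^σ = [ω̄] = [ω²]`).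
[folklore] -/
private theorem smul_cm_addEquiv_of_apply_eq_sq {ζ' : AlgebraicClosure k}
    {ψ : geomPoints W ≃+ geomPoints W}
    (hψ : ∀ {x y : AlgebraicClosure k} (h : (W.baseChange (AlgebraicClosure k)).toAffine.Nonsingular x y),
        ∃ h', ψ (Affine.Point.some x y h) = Affine.Point.some (ζ' * x) y h')
    {g : Field.absoluteGaloisGroup k}
    (hg : (show AlgebraicClosure k ≃ₐ[k] AlgebraicClosure k from g) ζ' = ζ' ^ 2) (P : geomPoints W) :
    g • ψ P = ψ (ψ (g • P)) := by
  change (W.baseChange (AlgebraicClosure k)).toAffine.Point at P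
  rcases P with _ | ⟨x, y, h⟩
  · change g • ψ 0 = ψ (ψ (g • (0 : geomPoints W)))
    rw [smul_zero, map_zero, map_zero, smul_zero]
  · obtain ⟨h₁, e₁⟩ := hψ h
    obtain ⟨h₂, e₂⟩ := smul_some_eq W g h₁
    obtain ⟨h₃, e₃⟩ := smul_some_eq W g h
    obtain ⟨h₄, e₄⟩ := hψ h₃
    obtain ⟨h₅, e₅⟩ := hψ h₄
    refine ((congrArg (g • ·) e₁).trans e₂).trans
      (Eq.symm (((congrArg (fun Q ↦ ψ (ψ Q)) e₃).trans ((congrArg ψ e₄).trans e₅)).trans ?_))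
    exact Affine.Point.some_eq_some_of_eq (by rw [map_mul, hg]; ring) rfl

omit [W.IsElliptic] in
/-- **The trace identity `[ω]² + [ω] + 1 = 0` on `E(k̄)`** for `ψ = [ω]` and `ζ'` a PRIMITIVE cube
root of unity (`char k = 0`): `(ζ'²x, y) + (ζ'x, y) + (x, y) = O`
(`horizontal_some_add_some_eq_neg`). Silverman, *AEC*, III.10.1. [folklore] -/
private theorem cm_addEquiv_trace [CharZero k] (ha₁ : W.a₁ = 0) (ha₂ : W.a₂ = 0) (ha₃ : W.a₃ = 0)
    (ha₄ : W.a₄ = 0) {ζ' : AlgebraicClosure k} (hζ'3 : ζ' ^ 3 = 1) (hζ'1 : ζ' ≠ 1)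
    {ψ : geomPoints W ≃+ geomPoints W}
    (hψ : ∀ {x y : AlgebraicClosure k} (h : (W.baseChange (AlgebraicClosure k)).toAffine.Nonsingular x y),
        ∃ h', ψ (Affine.Point.some x y h) = Affine.Point.some (ζ' * x) y h')
    (P : geomPoints W) : ψ (ψ P) + ψ P + P = 0 := by
  have hb₁ : (W.baseChange (AlgebraicClosure k)).a₁ = 0 := by simp [WeierstrassCurve.baseChange, ha₁]
  have hb₂ : (W.baseChange (AlgebraicClosure k)).a₂ = 0 := by simp [WeierstrassCurve.baseChange, ha₂]
  have hb₃ : (W.baseChange (AlgebraicClosure k)).a₃ = 0 := by simp [WeierstrassCurve.baseChange, ha₃]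
  have hb₄ : (W.baseChange (AlgebraicClosure k)).a₄ = 0 := by simp [WeierstrassCurve.baseChange, ha₄]
  haveI : CharZero (AlgebraicClosure k) :=
    charZero_of_injective_algebraMap (algebraMap k (AlgebraicClosure k)).injective
  have h2 : (2 : AlgebraicClosure k) ≠ 0 := two_ne_zero
  change (W.baseChange (AlgebraicClosure k)).toAffine.Point at P
  rcases P with _ | ⟨x, y, h⟩
  · change ψ (ψ 0) + ψ 0 + (0 : geomPoints W) = 0
    rw [map_zero, map_zero, add_zero, add_zero]
  · obtain ⟨h₁, e₁⟩ := hψ h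
    obtain ⟨h₂, e₂⟩ := hψ h₁
    have h₂' : (W.baseChange (AlgebraicClosure k)).toAffine.Nonsingular (ζ' ^ 2 * x) y := by
      have e : ζ' ^ 2 * x = ζ' * (ζ' * x) := by ring
      rw [e]; exact h₂
    have e₂' : ψ (ψ (Affine.Point.some x y h)) = Affine.Point.some (ζ' ^ 2 * x) y h₂' :=
      ((congrArg ψ e₁).trans e₂).trans (Affine.Point.some_eq_some_of_eq (by ring) rfl)
    have key := horizontal_some_add_some_eq_neg hb₁ hb₂ hb₃ hb₄ h2 hζ'3 hζ'1 h h₁ h₂'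
    rw [e₂', e₁]
    change (Affine.Point.some (ζ' ^ 2 * x) y h₂' + Affine.Point.some (ζ' * x) y h₁ +
      Affine.Point.some x y h : (W.baseChange (AlgebraicClosure k)).toAffine.Point) = 0
    rw [add_comm (Affine.Point.some (ζ' ^ 2 * x) y h₂'), key, neg_add_cancel]

/-- **`[ω]` with its Galois properties (public bundle).** For an elliptic `j = 0` short model
`E : y² = x³ + B` over a field `k` of characteristic `0` and a primitive cube root of unity `ζ' ∈ k̄`,
there is an additive automorphism `ψ = [ω]` of `E(k̄)` acting by `(x, y) ↦ (ζ' x, y)` such that: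
`ψ (g P) = g (ψ P)` whenever `g ζ' = ζ'`; `g (ψ P) = ψ (ψ (g P))` whenever `g ζ' = ζ'²`; and
`ψ² + ψ + 1 = 0`. Silverman, *AEC*, III.10.1. [cite: SilvermanAEC2009, Thm. III.10.1 and Cor. III.10.2] -/
theorem exists_cm_addEquiv_semilinear [CharZero k] (ha₁ : W.a₁ = 0) (ha₂ : W.a₂ = 0)
    (ha₃ : W.a₃ = 0) (ha₄ : W.a₄ = 0) {ζ' : AlgebraicClosure k} (hζ'3 : ζ' ^ 3 = 1)
    (hζ'1 : ζ' ≠ 1) :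
    ∃ ψ : geomPoints W ≃+ geomPoints W,
      (∀ {x y : AlgebraicClosure k} (h : (W.baseChange (AlgebraicClosure k)).toAffine.Nonsingular x y),
        ∃ h', ψ (Affine.Point.some x y h) = Affine.Point.some (ζ' * x) y h') ∧
      (∀ g : Field.absoluteGaloisGroup k,
        (show AlgebraicClosure k ≃ₐ[k] AlgebraicClosure k from g) ζ' = ζ' →
          ∀ P : geomPoints W, ψ (g • P) = g • ψ P) ∧
      (∀ g : Field.absoluteGaloisGroup k,
        (show AlgebraicClosure k ≃ₐ[k] AlgebraicClosure k from g) ζ' = ζ' ^ 2 →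
          ∀ P : geomPoints W, g • ψ P = ψ (ψ (g • P))) ∧
      ∀ P : geomPoints W, ψ (ψ P) + ψ P + P = 0 := by
  obtain ⟨ψ, hψ⟩ := exists_cm_addEquiv W ha₁ ha₂ ha₃ ha₄ hζ'3
  exact ⟨ψ, hψ, fun g hg P ↦ cm_addEquiv_smul_of_apply_eq hψ hg P,
    fun g hg P ↦ smul_cm_addEquiv_of_apply_eq_sq hψ hg P,
    fun P ↦ cm_addEquiv_trace ha₁ ha₂ ha₃ ha₄ hζ'3 hζ'1 hψ P⟩

end CMEndo

/-! ## §3 The subgroup model: invariant classes of `H¹(galRange K, E(ℚ̄))` are restrictions -/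

section SubgroupModel

variable (W : WeierstrassCurve ℚ) [W.IsElliptic] (K : Type) [Field K] [NumberField K]

/-- `σ ζ = ζ²` for a primitive cube root of unity forces `σ ≠ 1`. [folklore] -/
private theorem ne_one_of_apply_eq_sq {ζ : K} (hζ : IsPrimitiveRoot ζ 3) {σ : K ≃ₐ[ℚ] K}
    (hσζ : σ ζ = ζ ^ 2) : σ ≠ 1 := by
  intro h
  rw [h, AlgEquiv.one_apply] at hσζ
  have hζ0 : ζ ≠ 0 := hζ.ne_zero (by norm_num)
  have hζ1 : ζ ≠ 1 := hζ.ne_one (by norm_num)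
  have : ζ * (ζ - 1) = 0 := by linear_combination hσζ.symm
  rcases mul_eq_zero.mp this with h0 | h0
  · exact hζ0 h0
  · exact hζ1 (sub_eq_zero.mp h0)

/-- **INVARIANT CLASSES ARE RESTRICTIONS (subgroup model).** `E = W/ℚ` elliptic with all of
`a₁, …, a₄` zero (`y² = x³ + B`), `K` a quadratic number field with a primitive cube root of unity
`ζ` (`K ≅ ℚ(ω)`), `σ ∈ Aut(K/ℚ)` with `σ ζ = ζ²`, `c = liftToAbsGal K σ ∈ Γ_ℚ` its transported lift,
`N = galRange K = Γ_K ≤ Γ_ℚ`. Then every class `ξ ∈ H¹(N, E(ℚ̄))` with `c_* ξ = ξ` is the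
restriction of a class of `H¹(ℚ, E) = H¹(Γ_ℚ, E(ℚ̄))`: `ξ = res (cor (−[ω]_* ξ))`
(`resSubgroupH1_corH1_neg_h1Equiv_of_conjH1_eq` with `ψ = [ω]` of `exists_cm_addEquiv`, which
commutes with `Γ_K` (it fixes the embedded `ζ' = j(ζ)`), is `c`-semilinear (`c ζ' = ζ'²`) and
satisfies `[ω]² + [ω] + 1 = 0`). With the tree's `IsLiftOfAut.conjH1Points` / `modelIso` bookkeeping
this is the surjectivity of `res : H¹(ℚ, E) → H¹(K, E_K)^{⟨τ⟩}`; Gross 1991 §5 (5.1)–(5.2) is the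
odd-`p` Heegner analogue. [cite: SerreGaloisCohomology1997, I.§2.4 (Prop. 9 and Cor.) and I.§5.8]
[cite: SilvermanAEC2009, Thm. III.10.1 and Cor. III.10.2] -/
theorem exists_resSubgroupH1_eq_of_conjH1_eq (ha₁ : W.a₁ = 0) (ha₂ : W.a₂ = 0) (ha₃ : W.a₃ = 0)
    (ha₄ : W.a₄ = 0) (h2 : Module.finrank ℚ K = 2) {ζ : K} (hζ : IsPrimitiveRoot ζ 3)
    {σ : K ≃ₐ[ℚ] K} (hσζ : σ ζ = ζ ^ 2) [(galRange (K := ℚ) K).Normal]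
    {ξ : subgroupH1 (galRange (K := ℚ) K) (geomPoints W)}
    (hξ : conjH1 (galRange (K := ℚ) K) (geomPoints W) (liftToAbsGal (K := ℚ) K σ) ξ = ξ) :
    ∃ η : W.galH1, resSubgroupH1 (galRange (K := ℚ) K) (geomPoints W) η = ξ := by
  haveI : IsGalois ℚ K := by
    haveI : Algebra.IsQuadraticExtension ℚ K := ⟨h2⟩
    infer_instance
  have hσ1 : σ ≠ 1 := ne_one_of_apply_eq_sq K hζ hσζ
  have hN : IsOpen (galRange (K := ℚ) K : Set (Field.absoluteGaloisGroup ℚ)) := isOpen_galRange K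
  have hM : ∀ m : geomPoints W, Continuous fun g : Field.absoluteGaloisGroup ℚ ↦ g • m := fun P ↦
    continuous_smul_of_isOpen_stabilizer P (isOpen_stabilizer_point_holds W P)
  have hc := xor_galRange K h2 hσ1
  -- the embedded cube root `ζ' = j(ζ)` and the action of `Γ_ℚ` on it
  obtain ⟨ζ', hζ'⟩ : ∃ ζ' : AlgebraicClosure ℚ, embIntoClosure (K := ℚ) K ζ = ζ' := ⟨_, rfl⟩
  have hζ'3 : ζ' ^ 3 = 1 := by rw [← hζ', ← map_pow, hζ.pow_eq_one, map_one]
  have hζ'1 : ζ' ≠ 1 :=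
    (hζ' ▸ hζ.map_of_injective (embIntoClosure (K := ℚ) K).injective).ne_one (by norm_num)
  have hfix : ∀ n : galRange (K := ℚ) K,
      (show AlgebraicClosure ℚ ≃ₐ[ℚ] AlgebraicClosure ℚ from (n : Field.absoluteGaloisGroup ℚ)) ζ' =
        ζ' := fun n ↦ by
    rw [← hζ']
    exact smul_embIntoClosure_of_mem_galRange K n.2 ζ
  have hcζ : (show AlgebraicClosure ℚ ≃ₐ[ℚ] AlgebraicClosure ℚ from liftToAbsGal (K := ℚ) K σ) ζ' =
      ζ' ^ 2 := by
    rw [← hζ']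
    exact (liftToAbsGal_embIntoClosure (K := ℚ) K σ ζ).trans (by rw [hσζ, map_pow])
  -- `ψ = [ω]`
  obtain ⟨ψ, hψ⟩ := exists_cm_addEquiv W ha₁ ha₂ ha₃ ha₄ hζ'3
  have hψN : ∀ (n : galRange (K := ℚ) K) (m : geomPoints W), ψ (n • m) = n • ψ m := fun n m ↦
    cm_addEquiv_smul_of_apply_eq hψ (hfix n) m
  have hψc : ∀ m : geomPoints W, liftToAbsGal (K := ℚ) K σ • ψ m =
      ψ (ψ (liftToAbsGal (K := ℚ) K σ • m)) := fun m ↦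
    smul_cm_addEquiv_of_apply_eq_sq hψ hcζ m
  have hψ3 : ∀ m : geomPoints W, ψ (ψ m) + ψ m + m = 0 := fun m ↦
    cm_addEquiv_trace ha₁ ha₂ ha₃ ha₄ hζ'3 hζ'1 hψ m
  exact ⟨_, resSubgroupH1_corH1_neg_h1Equiv_of_conjH1_eq hN hM hc ψ hψN hψc hψ3 hξ⟩

/-- **The image of restriction is the invariants (subgroup model, set form)**: with notation as in
`exists_resSubgroupH1_eq_of_conjH1_eq`,
`res(H¹(ℚ, E)) = {ξ ∈ H¹(galRange K, E(ℚ̄)) | c_* ξ = ξ}`.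
[cite: SerreGaloisCohomology1997, I.§2.4 (Prop. 9 and Cor.) and I.§5.8]
[cite: SilvermanAEC2009, Thm. III.10.1 and Cor. III.10.2] -/
theorem range_resSubgroupH1_eq (ha₁ : W.a₁ = 0) (ha₂ : W.a₂ = 0) (ha₃ : W.a₃ = 0)
    (ha₄ : W.a₄ = 0) (h2 : Module.finrank ℚ K = 2) {ζ : K} (hζ : IsPrimitiveRoot ζ 3)
    {σ : K ≃ₐ[ℚ] K} (hσζ : σ ζ = ζ ^ 2) [(galRange (K := ℚ) K).Normal] :
    ((resSubgroupH1 (galRange (K := ℚ) K) (geomPoints W)).range :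
        Set (subgroupH1 (galRange (K := ℚ) K) (geomPoints W))) =
      {ξ | conjH1 (galRange (K := ℚ) K) (geomPoints W) (liftToAbsGal (K := ℚ) K σ) ξ = ξ} := by
  have hM : ∀ m : geomPoints W, Continuous fun g : Field.absoluteGaloisGroup ℚ ↦ g • m := fun P ↦
    continuous_smul_of_isOpen_stabilizer P (isOpen_stabilizer_point_holds W P)
  ext ξ
  simp only [SetLike.mem_coe, AddMonoidHom.mem_range, Set.mem_setOf_eq]
  constructor
  · rintro ⟨η, rfl⟩
    exact conjH1_resSubgroupH1 (galRange (K := ℚ) K) hM _ η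
  · exact fun hξ ↦ exists_resSubgroupH1_eq_of_conjH1_eq W K ha₁ ha₂ ha₃ ha₄ h2 hζ hσζ hξ

end SubgroupModel

end JZero

end Literature.NumberTheory.EllipticCurves
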